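import Summits.AtomisticToContinuum.FouriersLaw.Theorems.OddSectorIrreversibilityCorrectorTheoryExistence
import Mathlib.MeasureTheory.Integral.ExpDecay

/-!
# Stub `stub_openChainGreenKubo` (GK) of line `contact-current-forgetting` — Aux 1: the total-current
# autocorrelation is integrable on `(0, ∞)`

Helper file for crux `JunctionLocality.NonBallistic` (stmt-AtomisticToContinuum-9127), line
`contact-current-forgetting`, stub `stub_openChainGreenKubo` (the Kundu–Dhar–Narayan open-chain Green–Kubo identity,
= route item `HonestZwanzig.OpenChainGreenKubo`, stmt-AtomisticToContinuum-12696).  It proves, over TREE vocabulary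
(constructed kernels `transitionKernel N T T`, Gibbs measure `gibbsMeasure N T`, bond currents `bondCurrent N i`), the
FIRST clause of the stub: for the pinned anharmonic chain `pinnedChain ω₂ lam β γ` (`ω₂ > 0`, `lam ≥ 0`, `β, γ > 0`,
`N ≥ 1`, `T > 0`) the equilibrium total-current autocorrelation
`corr(J,J)(t) = ∫ J · (κ_t J) dμ_T − μ_T(J)·μ_T(J)`, `J = Σ_i j_i`, is integrable on `(0,∞)`:

* `pinnedChain_integrableOn_autocorr` — for ANY continuous observable `f` of exponential class `|f| ≤ C e^{ϑH}`
  (`0 < ϑ`, `2ϑ < 1/T`) with `μ_T(f) = 0`, `u ↦ K_f(u) = ∫ f · κ_{u⁺} f dμ_T` is integrable on `(0,∞)` (measurable,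
  `pinnedChain_measurable_autocorr`, and exponentially small, `pinnedChain_autocorr_exp_decay`, at fixed `N`);
* `pinnedChain_integrableOn_totalCorr` — the clause (registered sub-goal; colon form): `J` is continuous of
  exponential class for every `ϑ > 0` (`continuous_totalBondCurrent`, `abs_totalBondCurrent_le_exp`) and
  `μ_T(J) = 0` (`integral_totalBondCurrent_gibbsMeasure`, momentum parity).

No uniqueness of the steady state is needed (Gibbs invariance and exponential convergence at equal temperatures are in
tree without it).
-/

noncomputable section

open MeasureTheory ProbabilityTheory Filter Topology Set
open scoped NNReal ENNReal BigOperators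

namespace Summit.AtomisticToContinuum.FouriersLaw.Theorems.NonBallistic

open Literature.MathematicalPhysics.KineticTheory.HeatConduction
open Literature.MathematicalPhysics.KineticTheory OscillatorChain
open Summit.AtomisticToContinuum.FouriersLaw.Theorems.SubdiffusiveBondHeat
open Summit.AtomisticToContinuum.FouriersLaw.Theorems.LightConeBondHeat
open Summit.AtomisticToContinuum.FouriersLaw.Theorems.OddSectorIrreversibility.Corrector

section Generic

variable {ω₂ lam β γ : ℝ} (hω : 0 < ω₂) (hl : 0 ≤ lam) (hβ : 0 < β) (hγ : 0 < γ) {N : ℕ} (hN : 0 < N)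
  {T : ℝ} (hT : 0 < T) {ϑ C : ℝ} (hϑ0 : 0 < ϑ) (h2ϑ : 2 * ϑ < 1 / T) {f : PhaseSpace N → ℝ}
  (hf : Continuous f) (hfb : ∀ y, |f y| ≤ C * Real.exp (ϑ * (pinnedChain ω₂ lam β γ).hamiltonian N y))
include hω hl hβ hγ hN hT hϑ0 h2ϑ hf hfb

/-- **`K_f ∈ L¹(0,∞)` for centred observables of exponential class.**  If `f` is continuous with
`|f| ≤ C e^{ϑH}` (`0 < ϑ`, `2ϑ < 1/T`) and `∫ f dμ_T = 0`, then the equilibrium autocorrelation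
`u ↦ ∫ f · κ_{u⁺} f dμ_T` is integrable on `(0, ∞)`: it is measurable and `|K_f(u)| ≤ C' e^{−cu}` (`c > 0`) for
`u ≥ 0`. [folklore] -/
theorem pinnedChain_integrableOn_autocorr
    (h0 : ∫ z, f z ∂((pinnedChain ω₂ lam β γ).gibbsMeasure N T) = 0) :
    IntegrableOn (fun u : ℝ => ∫ z, f z *
        (∫ y, f y ∂((pinnedChain ω₂ lam β γ).transitionKernel N T T u.toNNReal z))
      ∂((pinnedChain ω₂ lam β γ).gibbsMeasure N T)) (Ioi 0) := by
  obtain ⟨C', c, hc, hdec⟩ := pinnedChain_autocorr_exp_decay hω hl hβ hγ hN hT hϑ0 h2ϑ hf hfb h0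
  have hmeas := pinnedChain_measurable_autocorr hω hl hT hf hβ.le hγ.le (N := N)
  refine Integrable.mono' ((exp_neg_integrableOn_Ioi 0 hc).const_mul C') hmeas.aestronglyMeasurable ?_
  refine (ae_restrict_iff' measurableSet_Ioi).2 (Eventually.of_forall fun u hu => ?_)
  rw [Real.norm_eq_abs]
  exact hdec u (le_of_lt hu)

end Generic

/-- **The total-current autocorrelation is integrable on `(0,∞)` (first clause of GK).**  For the pinned chain with
both baths at `T > 0` (`ω₂ > 0`, `lam ≥ 0`, `β, γ > 0`, `N ≥ 1`):
`t ↦ ∫ J · (κ_t J) dμ_T − (∫ J dμ_T)·(∫ J dμ_T)`, `J = Σ_i j_i`, `κ_t = transitionKernel N T T t⁺`, is integrable on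
`(0, ∞)` — `J` is continuous of exponential class with `μ_T(J) = 0`, so `pinnedChain_integrableOn_autocorr` applies and
the subtracted constant vanishes. [folklore] -/
theorem pinnedChain_integrableOn_totalCorr :
    ∀ (ω₂ lam β γ : ℝ), 0 < ω₂ → 0 ≤ lam → 0 < β → 0 < γ → ∀ (N : ℕ), 0 < N → ∀ (T : ℝ), 0 < T →
      IntegrableOn (fun t : ℝ =>
        (∫ z, (∑ i : Fin N, (pinnedChain ω₂ lam β γ).bondCurrent N i z) *
            (∫ y, ∑ i : Fin N, (pinnedChain ω₂ lam β γ).bondCurrent N i y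
              ∂((pinnedChain ω₂ lam β γ).transitionKernel N T T t.toNNReal z))
          ∂((pinnedChain ω₂ lam β γ).gibbsMeasure N T)) -
        (∫ z, ∑ i : Fin N, (pinnedChain ω₂ lam β γ).bondCurrent N i z
            ∂((pinnedChain ω₂ lam β γ).gibbsMeasure N T)) *
          (∫ z, ∑ i : Fin N, (pinnedChain ω₂ lam β γ).bondCurrent N i z
            ∂((pinnedChain ω₂ lam β γ).gibbsMeasure N T))) (Ioi 0) := by
  intro ω₂ lam β γ hω hl hβ hγ N hN T hT
  have h0 := integral_totalBondCurrent_gibbsMeasure ω₂ lam β γ N T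
  simp only [h0, mul_zero, sub_zero]
  obtain ⟨hϑ0, h2ϑ⟩ := quarter_inv_temp_admissible hT
  obtain ⟨M, -, hM⟩ := abs_totalBondCurrent_le_exp hω.le hl hβ.le γ N hϑ0
  exact pinnedChain_integrableOn_autocorr hω hl hβ hγ hN hT hϑ0 h2ϑ (continuous_totalBondCurrent ω₂ lam β γ N) hM h0

end Summit.AtomisticToContinuum.FouriersLaw.Theorems.NonBallistic

end
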